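import Literature.NumberTheory.Automorphic.HyperspecialUnitaryIwasawaExponents
import Literature.Analysis.TotalPositivity.MultiplyPositiveProofs
import HarnessLib

/-!
# Iwasawa versus Cartan for the quasi-split unitary group `U(σ, J₀)`: the Iwasawa exponents of the cosets in
# `K₀ diag(ϖ^a) K₀` are dominated by `a` (Bruhat–Tits 1972, Prop. (4.4.4) (i))

Topic `NumberTheory/Automorphic`; namespaces `Literature.NumberTheory.Automorphic.CartanUnique` (§§1–4, any field `K`
with `Valued K ℤᵐ⁰`, plain matrices) and `Literature.NumberTheory.Automorphic.HermitianLattice.UnramifiedLocalConjDatum`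
(§5) (lane `lit-hodgefound`, Track 2 foundations; seat `lit-hodgefound-p11`, generation 36, row g36-#7).  THEOREMS ONLY:
no definition, no named fact, no instance, no notation.

## The print, verbatim

[BruhatTits1972] F. Bruhat, J. Tits, *Groupes réductifs sur un corps local I*, Publ. Math. IHÉS 41 (1972), Prop. (4.4.4)
(held text `paper:doi-10-1007-bf02715544`, p0077 = p. 80, L34–L52): «Explicitons maintenant certaines des relations de 4.3
dans le cas qui nous intéresse, ce qui va nous donner des relations entre les décompositions d'Iwasawa et de Cartan de
`G` : Proposition. — Supposons `φ` de type connexe. Soit `K` un bon sous-groupe borné maximal de `G` contenant `B̂` et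
soient `t ∈ V_D`, `t' ∈ V`. (i) Si `K.t.K ∩ B̂⁰.t'.K ≠ ∅`, on a `t' ≤ t` (autrement dit `p(t − t') ≥ 0` pour tout poids
dominant `p` (relativement à `D`) de `V`).»  Here `G = U(σ, J₀)`, `K = K₀ = U(σ, J₀) ∩ GL_N(𝒪)` (hyperspecial),
`B̂⁰ ⊇ N` the upper unitriangular elements, `V = {diag(ϖ^a) : a ∘ rev = -a}`, `V_D` = the `a` with
`a_0 ≥ a_1 ≥ ⋯ ≥ a_{N-1}`, and the dominant weights of the relative root system (type `C_n` / `BC_n`) are the head sums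
`p_r(a) = a_0 + ⋯ + a_{r-1}` (`2r ≤ N`), so `t' ≤ t` reads `∑_{i<r} a'_i ≤ ∑_{i<r} a_i` for all `r`.  The same
triangularity is step (c) of the proof of [CartierCorvallis1979] Thm. 4.1 and [Macdonald1995] Ch. V (2.6)–(2.7) for
`GL_n`; it is what makes the Satake transform injective (sequel `HyperspecialUnitarySatakeInjective`).

## The proof formalised (minors; no root-system machinery)

For `g = u · diag(ϖ^{a'}) · k ∈ K₀ diag(ϖ^a) K₀` put `b = u diag(ϖ^{a'}) = k₁ diag(ϖ^a) k₂ k⁻¹` (all `k`'s integral).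
Every `r × r` minor of `k₁ diag(ϖ^a) k₂ k⁻¹` has valuation `≤ |ϖ|^{s_r(a)}`, `s_r(a) = ∑_{i ≥ N-r} a_i` the sum of the `r`
smallest exponents (§§1–3: minors of a product with an integral matrix are `𝒪`-combinations of minors —
`det_mul_eq_sum_pi` of `Literature.Analysis.TotalPositivity` — and the minors of `diag(ϖ^a)` are `0` or
`± ϖ^{∑_{i ∈ S} a_i}`, `#S = r`), while the lower-right `r × r` corner minor of the upper triangular `b` is
`∏_{i ≥ N-r} b_ii = unit · ϖ^{∑_{i ≥ N-r} a'_i}` (§4).  Hence `∑_{i ≥ N-r} a_i ≤ ∑_{i ≥ N-r} a'_i` for every `r`, which for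
antisymmetric `a, a'` is `∑_{i < r} a'_i ≤ ∑_{i < r} a_i` (§5, reindexing by `rev`).

## What is formalised

* §1 `v_prod_le_one`, **`v_det_submatrix_mul_le`**, **`v_det_submatrix_mul_le'`** (right / left multiplication by an
  integral matrix preserves a bound on all `r × r` minors).
* §2 `sum_ite_le_sum_of_injective` (for antitone `a : Fin N → ℤ` and `r` distinct indices `c`, `∑_{i ≥ N-r} a_i ≤ ∑_j
  a_{c j}`), `prod_exp_neg_eq` (`∏ exp(-f i) = exp(-∑ f i)`).
* §3 `v_det_submatrix_diagonal_zpow_le` (minors of `diag(ϖ^a)`), `v_det_submatrix_le_of_eq_mul_diagonal_mul` (minors on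
  `k₁ diag(ϖ^a) k₂ P`, all three integral).
* §4 `blockTriangular_submatrix_of_strictMono`, `det_submatrix_last_of_blockTriangular` (corner minor of an upper
  triangular matrix), `sum_last_eq_sum_ite`, **`sum_ite_le_sum_ite_of_blockTriangular_eq`** (the `GL_N` statement over a
  `Valued` field: `b` upper triangular with `v(b_ii) = exp(-a'_i)`, `b = k₁ diag(ϖ^a) k₂ P` ⇒
  `∑_{i ≥ N-r} a_i ≤ ∑_{i ≥ N-r} a'_i`).
* §5 `U(σ, J₀)` under `UnramifiedLocalConjDatum σ ϖ`: `sum_ite_rev_eq_neg` (antisymmetry turns tail sums into minus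
  head sums), `eq_of_forall_sum_ite_lt_eq` (head sums determine the vector),
  **`UnramifiedLocalConjDatum.sum_iwasawaExp_tail_ge`** and **`UnramifiedLocalConjDatum.sum_iwasawaExp_head_le`** —
  PROP. (4.4.4) (i): for `gK₀ ⊆ K₀ diag(ϖ^a) K₀` with `a` antitone, `a ∘ rev = -a`, and every `r`,
  `∑_{i<r} a(g)_i ≤ ∑_{i<r} a_i` (`a(g) = iwasawaExp`); `iwasawaExp_out_zpowDiagGL` (the top term `a` occurs) and
  `UnramifiedLocalConjDatum.iwasawaExp_eq_of_mem_orbit_of_forall_le` (if also `∑_{i<r} a_i ≤ ∑_{i<r} a(g)_i` for all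
  `r`, then `a(g) = a`).

## References
* [BruhatTits1972] F. Bruhat, J. Tits, *Groupes réductifs sur un corps local. I*, Publ. Math. IHÉS 41 (1972), (4.4.4).
* [CartierCorvallis1979] P. Cartier, *Representations of 𝔭-adic groups: a survey*, PSPM 33.1 (1979), §IV, proof of
  Thm. 4.1.
* [Macdonald1995] I. G. Macdonald, *Symmetric Functions and Hall Polynomials*, 2nd ed. (1995), Ch. II §1, Ch. V (2.6).
-/

noncomputable section

open scoped Valued WithZero Matrix MatrixGroups
open Matrix Finset

namespace Literature.NumberTheory.Automorphic.CartanUnique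

variable {K : Type*} [Field K] [Valued K ℤᵐ⁰] {N : ℕ}

/-! ## §1 Minors under multiplication by integral matrices -/

/-- A product of integral elements is integral. [cite: Macdonald1995, Ch. II §1] -/
theorem v_prod_le_one {ι : Type*} (s : Finset ι) {f : ι → K} (hf : ∀ i ∈ s, Valued.v (f i) ≤ 1) :
    Valued.v (∏ i ∈ s, f i) ≤ 1 := by
  rw [map_prod]
  exact Finset.prod_le_one' hf

/-- **Right multiplication by an integral matrix preserves a bound on the `r × r` minors**: if every `r × r` minor of
`M` with injective column selection has valuation `≤ t` and `P` is integral, then every `r × r` minor of `M P` has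
valuation `≤ t` (the columns of `M P` are `𝒪`-combinations of the columns of `M`). [cite: Macdonald1995, Ch. II §1] -/
theorem v_det_submatrix_mul_le {r : ℕ} {t : ℤᵐ⁰} {M P : Matrix (Fin N) (Fin N) K}
    (hM : ∀ (ρ c : Fin r → Fin N), Function.Injective c → Valued.v (M.submatrix ρ c).det ≤ t)
    (hP : ∀ i j, Valued.v (P i j) ≤ 1) (ρ c : Fin r → Fin N) :
    Valued.v ((M * P).submatrix ρ c).det ≤ t := by
  classical
  rw [Matrix.submatrix_mul M P ρ id c Function.bijective_id, Literature.Analysis.TotalPositivity.det_mul_eq_sum_pi]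
  refine Valuation.map_sum_le _ fun p _ => ?_
  rw [map_mul]
  have h1 : Valued.v (∏ i, (P.submatrix id c) (p i) i) ≤ 1 := v_prod_le_one _ fun i _ => hP (p i) (c i)
  have h2 : Valued.v ((M.submatrix ρ id).submatrix id p).det ≤ t := by
    by_cases hp : Function.Injective p
    · rw [Matrix.submatrix_submatrix, Function.comp_id, Function.id_comp]
      exact hM ρ p hp
    · rw [Literature.Analysis.TotalPositivity.det_submatrix_eq_zero_of_not_injective _ hp, map_zero]
      exact zero_le
  calc Valued.v (∏ i, (P.submatrix id c) (p i) i) * Valued.v ((M.submatrix ρ id).submatrix id p).det ≤ 1 * t :=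
      mul_le_mul' h1 h2
    _ = t := one_mul t

/-- **Left multiplication by an integral matrix preserves a bound on the `r × r` minors** (rows are
`𝒪`-combinations of rows; the transpose of `v_det_submatrix_mul_le`). [cite: Macdonald1995, Ch. II §1] -/
theorem v_det_submatrix_mul_le' {r : ℕ} {t : ℤᵐ⁰} {M P : Matrix (Fin N) (Fin N) K}
    (hP : ∀ i j, Valued.v (P i j) ≤ 1)
    (hM : ∀ (ρ c : Fin r → Fin N), Function.Injective c → Valued.v (M.submatrix ρ c).det ≤ t)
    (ρ c : Fin r → Fin N) (hc : Function.Injective c) :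
    Valued.v ((P * M).submatrix ρ c).det ≤ t := by
  classical
  rw [← Matrix.det_transpose, Matrix.transpose_submatrix, Matrix.transpose_mul,
    Matrix.submatrix_mul _ _ c id ρ Function.bijective_id, Literature.Analysis.TotalPositivity.det_mul_eq_sum_pi]
  refine Valuation.map_sum_le _ fun p _ => ?_
  rw [map_mul]
  have h1 : Valued.v (∏ i, (P.transpose.submatrix id ρ) (p i) i) ≤ 1 := v_prod_le_one _ fun i _ => hP (ρ i) (p i)
  have h2 : Valued.v ((M.transpose.submatrix c id).submatrix id p).det ≤ t := by
    rw [Matrix.submatrix_submatrix, Function.comp_id, Function.id_comp, ← Matrix.transpose_submatrix,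
      Matrix.det_transpose]
    exact hM p c hc
  calc Valued.v (∏ i, (P.transpose.submatrix id ρ) (p i) i) * Valued.v ((M.transpose.submatrix c id).submatrix id p).det
      ≤ 1 * t := mul_le_mul' h1 h2
    _ = t := one_mul t

/-! ## §2 Tail sums of an antitone integer vector -/

/-- **The `r` smallest values have the smallest sum**: for `a : Fin N → ℤ` antitone and `r` DISTINCT indices
`c : Fin r → Fin N`, `∑_{i ≥ N-r} a_i ≤ ∑_j a_{c j}` (the exponent of the smallest `r × r` minor of `diag(ϖ^a)`).
[cite: Macdonald1995, Ch. II §1] -/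
theorem sum_ite_le_sum_of_injective {a : Fin N → ℤ} (ha : Antitone a) {r : ℕ} {c : Fin r → Fin N}
    (hc : Function.Injective c) : (∑ i : Fin N, if N ≤ (i : ℕ) + r then a i else 0) ≤ ∑ j, a (c j) := by
  classical
  set S : Finset (Fin N) := univ.image c with hS
  set T : Finset (Fin N) := univ.filter (fun i : Fin N => N ≤ (i : ℕ) + r) with hT
  have hsumS : ∑ j, a (c j) = ∑ j ∈ S, a j := by
    rw [hS, Finset.sum_image fun x _ y _ h => hc h]
  rw [hsumS, ← Finset.sum_filter, ← hT]
  have hr : r ≤ N := by simpa using Fintype.card_le_of_injective c hc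
  have hcardS : S.card = r := by
    rw [hS, Finset.card_image_of_injective _ hc, card_univ, Fintype.card_fin]
  have hcardT : T.card = r := by
    have hT' : T = univ.image (fun j : Fin r => (⟨N - r + j, by omega⟩ : Fin N)) := by
      ext i
      simp only [hT, Finset.mem_filter, Finset.mem_univ, true_and, Finset.mem_image]
      constructor
      · intro hi
        exact ⟨⟨i - (N - r), by omega⟩, Fin.ext (by simp; omega)⟩
      · rintro ⟨j, rfl⟩
        simp
        omega
    rw [hT', Finset.card_image_of_injective, card_univ, Fintype.card_fin]
    intro j j' h
    simp only [Fin.mk.injEq] at h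
    exact Fin.ext (by omega)
  -- split both sums along `S ∩ T`
  have h1 : ∑ j ∈ T, a j = ∑ j ∈ T \ S, a j + ∑ j ∈ T ∩ S, a j := by
    rw [← Finset.sum_sdiff (Finset.inter_subset_left : T ∩ S ⊆ T), Finset.sdiff_inter_self_left]
  have h2 : ∑ j ∈ S, a j = ∑ j ∈ S \ T, a j + ∑ j ∈ S ∩ T, a j := by
    rw [← Finset.sum_sdiff (Finset.inter_subset_left : S ∩ T ⊆ S), Finset.sdiff_inter_self_left]
  rw [h1, h2, Finset.inter_comm T S]
  refine add_le_add (α := ℤ) ?_ le_rfl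
  -- the two difference sets have the same cardinality
  have hcard : (T \ S).card = (S \ T).card := by
    have e1 := Finset.card_sdiff_add_card_inter T S
    have e2 := Finset.card_sdiff_add_card_inter S T
    rw [Finset.inter_comm S T] at e2
    omega
  rcases (S \ T).eq_empty_or_nonempty with he | hne
  · rw [he, Finset.card_empty, Finset.card_eq_zero] at hcard
    rw [hcard, he]
  · obtain ⟨j₀, hj₀⟩ := hne
    have hj₀' : (j₀ : ℕ) + r < N := by
      have := (Finset.mem_sdiff.1 hj₀).2
      simp only [hT, Finset.mem_filter, Finset.mem_univ, true_and, not_le] at this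
      exact this
    have hr0 : 0 < r := by
      rw [← hcardS]
      exact Finset.card_pos.2 ⟨j₀, (Finset.mem_sdiff.1 hj₀).1⟩
    set i₀ : Fin N := ⟨N - r, by omega⟩ with hi₀
    calc ∑ j ∈ T \ S, a j ≤ (T \ S).card • a i₀ := by
          refine Finset.sum_le_card_nsmul _ _ _ fun i hi => ha ?_
          have := (Finset.mem_sdiff.1 hi).1
          simp only [hT, Finset.mem_filter, Finset.mem_univ, true_and] at this
          change (N - r : ℕ) ≤ (i : ℕ)
          omega
      _ = (S \ T).card • a i₀ := by rw [hcard]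
      _ ≤ ∑ j ∈ S \ T, a j := by
          refine Finset.card_nsmul_le_sum _ _ _ fun j hj => ha ?_
          have := (Finset.mem_sdiff.1 hj).2
          simp only [hT, Finset.mem_filter, Finset.mem_univ, true_and, not_le] at this
          change (j : ℕ) ≤ (N - r : ℕ)
          omega

/-- `∏_i exp(-f i) = exp(-∑_i f i)` in `ℤᵐ⁰` (valuation of `∏ ϖ^{f i}`). [cite: Macdonald1995, Ch. II §1] -/
theorem prod_exp_neg_eq {ι : Type*} (s : Finset ι) (f : ι → ℤ) :
    ∏ i ∈ s, WithZero.exp (-f i) = WithZero.exp (-∑ i ∈ s, f i) := by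
  classical
  induction s using Finset.induction_on with
  | empty => simp
  | insert a s ha ih => rw [Finset.prod_insert ha, Finset.sum_insert ha, ih, ← WithZero.exp_add, neg_add]

/-! ## §3 The minors of `diag(ϖ^a)` and of `k₁ diag(ϖ^a) k₂ P` -/

variable {ϖ : K}

/-- **The minors of `diag(ϖ^a)`**: for `a` antitone, every `r × r` minor of `diagonal(ϖ^{a_i})` with injective column
selection `c` has valuation `≤ exp(-∑_{i ≥ N-r} a_i)` (it is `0` or `± ∏_j ϖ^{a_{c j}}`). [cite: Macdonald1995, Ch. II §1] -/
theorem v_det_submatrix_diagonal_zpow_le (hϖ : Valued.v ϖ = WithZero.exp (-1 : ℤ)) {a : Fin N → ℤ} (ha : Antitone a)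
    {r : ℕ} (ρ c : Fin r → Fin N) (hc : Function.Injective c) :
    Valued.v ((Matrix.diagonal fun i => ϖ ^ a i).submatrix ρ c).det ≤
      WithZero.exp (-∑ i : Fin N, if N ≤ (i : ℕ) + r then a i else 0) := by
  classical
  rw [Matrix.det_apply']
  refine Valuation.map_sum_le _ fun τ _ => ?_
  have hterm : Valued.v (∏ i, (Matrix.diagonal fun i => ϖ ^ a i).submatrix ρ c (τ i) i) ≤
      WithZero.exp (-∑ i : Fin N, if N ≤ (i : ℕ) + r then a i else 0) := by
    rw [map_prod]
    calc ∏ i, Valued.v ((Matrix.diagonal fun i => ϖ ^ a i).submatrix ρ c (τ i) i)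
        ≤ ∏ i, WithZero.exp (-a (c i)) := by
          refine Finset.prod_le_prod' fun i _ => ?_
          rw [Matrix.submatrix_apply, Matrix.diagonal_apply]
          split_ifs with h
          · rw [h, v_uniformizer_zpow hϖ]
          · rw [map_zero]; exact zero_le
      _ = WithZero.exp (-∑ i, a (c i)) := prod_exp_neg_eq _ _
      _ ≤ WithZero.exp (-∑ i : Fin N, if N ≤ (i : ℕ) + r then a i else 0) := by
          rw [WithZero.exp_le_exp, neg_le_neg_iff]
          exact sum_ite_le_sum_of_injective ha hc
  have hsign : Valued.v (((Equiv.Perm.sign τ : ℤˣ) : ℤ) : K) ≤ 1 := by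
    rcases Int.units_eq_one_or (Equiv.Perm.sign τ) with h | h
    · rw [h, Units.val_one, Int.cast_one, map_one]
    · rw [h, Units.val_neg, Units.val_one, Int.cast_neg, Int.cast_one, Valuation.map_neg, map_one]
  rw [map_mul]
  calc Valued.v (((Equiv.Perm.sign τ : ℤˣ) : ℤ) : K) * Valued.v (∏ i, (Matrix.diagonal fun i => ϖ ^ a i).submatrix ρ c (τ i) i)
      ≤ 1 * WithZero.exp (-∑ i : Fin N, if N ≤ (i : ℕ) + r then a i else 0) := mul_le_mul' hsign hterm
    _ = _ := one_mul _

/-- **Minors on `K diag(ϖ^a) K · P`** (the easy half of the theory of elementary divisors): for `k₁, k₂, P` integral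
matrices and `a` antitone, every `r × r` minor of `k₁ · diag(ϖ^a) · k₂ · P` has valuation `≤ exp(-∑_{i ≥ N-r} a_i)`.
[cite: Macdonald1995, Ch. II §1] -/
theorem v_det_submatrix_le_of_eq_mul_diagonal_mul (hϖ : Valued.v ϖ = WithZero.exp (-1 : ℤ)) {a : Fin N → ℤ}
    (ha : Antitone a) {k₁ k₂ P b : Matrix (Fin N) (Fin N) K} (hk₁ : ∀ i j, Valued.v (k₁ i j) ≤ 1)
    (hk₂ : ∀ i j, Valued.v (k₂ i j) ≤ 1) (hP : ∀ i j, Valued.v (P i j) ≤ 1)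
    (h : b = k₁ * (Matrix.diagonal fun i => ϖ ^ a i) * k₂ * P) {r : ℕ} (ρ c : Fin r → Fin N) :
    Valued.v ((b.submatrix ρ c).det) ≤ WithZero.exp (-∑ i : Fin N, if N ≤ (i : ℕ) + r then a i else 0) := by
  rw [h]
  refine v_det_submatrix_mul_le (fun ρ' c' _ => ?_) hP ρ c
  refine v_det_submatrix_mul_le (fun ρ'' c'' hc'' => ?_) hk₂ ρ' c'
  exact v_det_submatrix_mul_le' hk₁ (fun ρ₃ c₃ hc₃ => v_det_submatrix_diagonal_zpow_le hϖ ha ρ₃ c₃ hc₃) ρ'' c'' hc''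

/-! ## §4 The corner minor of an upper triangular matrix; the `GL_N` inequality -/

omit [Valued K ℤᵐ⁰] in
/-- A principal submatrix of an upper triangular matrix along an increasing selection of indices is upper triangular.
[cite: BruhatTits1972, (4.4.4)] -/
theorem blockTriangular_submatrix_of_strictMono {b : Matrix (Fin N) (Fin N) K} (hb : b.BlockTriangular id) {r : ℕ}
    {f : Fin r → Fin N} (hf : StrictMono f) : (b.submatrix f f).BlockTriangular id := by
  intro i j hij
  exact hb (hf hij)

omit [Valued K ℤᵐ⁰] in
/-- **The lower-right `r × r` corner minor of an upper triangular matrix is the product of its last `r` diagonal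
entries.** [cite: BruhatTits1972, (4.4.4)] -/
theorem det_submatrix_last_of_blockTriangular {b : Matrix (Fin N) (Fin N) K} (hb : b.BlockTriangular id) {r : ℕ}
    (hr : r ≤ N) :
    (b.submatrix (fun j : Fin r => (⟨N - r + j, by omega⟩ : Fin N)) (fun j : Fin r => (⟨N - r + j, by omega⟩ : Fin N))).det =
      ∏ j : Fin r, b ⟨N - r + j, by omega⟩ ⟨N - r + j, by omega⟩ := by
  have hf : StrictMono (fun j : Fin r => (⟨N - r + j, by omega⟩ : Fin N)) := fun i j hij => by
    rw [Fin.lt_def] at hij ⊢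
    dsimp only
    omega
  rw [Matrix.det_of_upperTriangular (blockTriangular_submatrix_of_strictMono hb hf)]
  rfl

/-- The last `r` diagonal entries, summed through the embedding `j ↦ N - r + j`, give the tail sum.
[cite: BruhatTits1972, (4.4.4)] -/
theorem sum_last_eq_sum_ite {r : ℕ} (hr : r ≤ N) (f : Fin N → ℤ) :
    ∑ j : Fin r, f ⟨N - r + j, by omega⟩ = ∑ i : Fin N, if N ≤ (i : ℕ) + r then f i else 0 := by
  classical
  rw [← Finset.sum_filter]
  have hT : univ.filter (fun i : Fin N => N ≤ (i : ℕ) + r) =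
      univ.image (fun j : Fin r => (⟨N - r + j, by omega⟩ : Fin N)) := by
    ext i
    simp only [Finset.mem_filter, Finset.mem_univ, true_and, Finset.mem_image]
    constructor
    · intro hi
      exact ⟨⟨i - (N - r), by omega⟩, Fin.ext (by simp; omega)⟩
    · rintro ⟨j, rfl⟩
      simp
      omega
  rw [hT, Finset.sum_image]
  intro j _ j' _ h
  simp only [Fin.mk.injEq] at h
  exact Fin.ext (by omega)

/-- **Iwasawa versus Cartan for `GL_N` over a `Valued` field, on the diagonal**: if `b` is upper triangular with
`v(b_ii) = exp(-a'_i)` and `b = k₁ · diag(ϖ^a) · k₂ · P` with `k₁, k₂, P` integral and `a` antitone, then for every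
`r ≤ N` the tail sums satisfy `∑_{i ≥ N-r} a_i ≤ ∑_{i ≥ N-r} a'_i` (compare the corner minor `∏_{i ≥ N-r} b_ii` with the
bound on all `r × r` minors). [cite: BruhatTits1972, (4.4.4) (i)] [cite: Macdonald1995, Ch. V (2.6)] -/
theorem sum_ite_le_sum_ite_of_blockTriangular_eq (hϖ : Valued.v ϖ = WithZero.exp (-1 : ℤ)) {a a' : Fin N → ℤ}
    (ha : Antitone a) {k₁ k₂ P b : Matrix (Fin N) (Fin N) K} (hb : b.BlockTriangular id)
    (hdiag : ∀ i, Valued.v (b i i) = WithZero.exp (-a' i)) (hk₁ : ∀ i j, Valued.v (k₁ i j) ≤ 1)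
    (hk₂ : ∀ i j, Valued.v (k₂ i j) ≤ 1) (hP : ∀ i j, Valued.v (P i j) ≤ 1)
    (h : b = k₁ * (Matrix.diagonal fun i => ϖ ^ a i) * k₂ * P) {r : ℕ} (hr : r ≤ N) :
    (∑ i : Fin N, if N ≤ (i : ℕ) + r then a i else 0) ≤ ∑ i : Fin N, if N ≤ (i : ℕ) + r then a' i else 0 := by
  have h1 := v_det_submatrix_le_of_eq_mul_diagonal_mul hϖ ha hk₁ hk₂ hP h
    (fun j : Fin r => (⟨N - r + j, by omega⟩ : Fin N)) (fun j : Fin r => (⟨N - r + j, by omega⟩ : Fin N))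
  rw [det_submatrix_last_of_blockTriangular hb hr, map_prod] at h1
  simp_rw [hdiag] at h1
  rw [prod_exp_neg_eq, sum_last_eq_sum_ite hr, WithZero.exp_le_exp, neg_le_neg_iff] at h1
  exact h1

end Literature.NumberTheory.Automorphic.CartanUnique

/-! ## §5 `U(σ, J₀)`: Bruhat–Tits (4.4.4) (i) -/

namespace Literature.NumberTheory.Automorphic.HermitianLattice

open Literature.NumberTheory.Automorphic.CartanUnique Literature.NumberTheory.Automorphic.SymplecticCartan

variable {K : Type*} [Field K] [Valued K ℤᵐ⁰] {σ : K →+* K} {ϖ : K} {N : ℕ}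

omit [Valued K ℤᵐ⁰] in
/-- **Antisymmetry turns tail sums into head sums**: for `a ∘ rev = -a`,
`∑_{i ≥ N-r} a_i = -∑_{i < r} a_i`. [cite: BruhatTits1972, (4.4.4)] -/
theorem sum_ite_rev_eq_neg {a : Fin N → ℤ} (ha : ∀ i, a (Fin.rev i) = -a i) (r : ℕ) :
    (∑ i : Fin N, if N ≤ (i : ℕ) + r then a i else 0) = -∑ i : Fin N, if (i : ℕ) < r then a i else 0 := by
  rw [← Equiv.sum_comp Fin.revPerm, ← Finset.sum_neg_distrib]
  refine Finset.sum_congr rfl fun i _ => ?_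
  rw [Fin.revPerm_apply, ha, Fin.val_rev]
  have hi := i.isLt
  by_cases h : (i : ℕ) < r
  · rw [if_pos (by omega), if_pos h]
  · rw [if_neg (by omega), if_neg h, neg_zero]

/-- Head sums determine the vector: if `∑_{i<r} f_i = ∑_{i<r} g_i` for all `r`, then `f = g` (the dominance order is an
order). [cite: BruhatTits1972, (4.4.4)] -/
theorem eq_of_forall_sum_ite_lt_eq {f g : Fin N → ℤ}
    (h : ∀ r : ℕ, (∑ i : Fin N, if (i : ℕ) < r then f i else 0) = ∑ i : Fin N, if (i : ℕ) < r then g i else 0) : f = g := by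
  funext j
  have h1 := h ((j : ℕ) + 1)
  have h2 := h (j : ℕ)
  have key : ∀ φ : Fin N → ℤ, (∑ i : Fin N, if (i : ℕ) < (j : ℕ) + 1 then φ i else 0) =
      (∑ i : Fin N, if (i : ℕ) < (j : ℕ) then φ i else 0) + φ j := fun φ => by
    have hsplit : ∀ i : Fin N, (if (i : ℕ) < (j : ℕ) + 1 then φ i else 0) =
        (if (i : ℕ) < (j : ℕ) then φ i else 0) + if i = j then φ i else 0 := fun i => by
      by_cases hij : i = j
      · subst hij; simp
      · have hne : (i : ℕ) ≠ (j : ℕ) := fun h => hij (Fin.ext h)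
        by_cases hlt : (i : ℕ) < (j : ℕ)
        · rw [if_pos (by omega), if_pos hlt, if_neg hij, add_zero]
        · rw [if_neg (by omega), if_neg hlt, if_neg hij, add_zero]
    simp_rw [hsplit]
    rw [Finset.sum_add_distrib, Finset.sum_ite_eq' Finset.univ j, if_pos (Finset.mem_univ j)]
  rw [key, key, h2] at h1
  exact add_left_cancel h1

namespace UnramifiedLocalConjDatum

/-- **Bruhat–Tits (4.4.4) (i) for `U(σ, J₀)`, tail form**: if `gK₀ ⊆ K₀ diag(ϖ^a) K₀` with `a` antitone and
`a ∘ rev = -a`, then `∑_{i ≥ N-r} a_i ≤ ∑_{i ≥ N-r} a(g)_i` for every `r ≤ N`, `a(g)` the Iwasawa exponents.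
[cite: BruhatTits1972, (4.4.4) (i)] -/
theorem sum_iwasawaExp_tail_ge (hd : UnramifiedLocalConjDatum σ ϖ) {a : Fin N → ℤ}
    (ha : Antitone a ∧ ∀ i, a (Fin.rev i) = -a i) {g : unitaryGroupOfForm σ ((StdForm.antidiagonal N).over K)}
    (hg : (g : unitaryGroupOfForm σ ((StdForm.antidiagonal N).over K) ⧸ unitaryInt σ ((StdForm.antidiagonal N).over K)) ∈
      MulAction.orbit (unitaryInt σ ((StdForm.antidiagonal N).over K))
        (((⟨zpowDiagGL (uniformizer_ne_zero hd.vϖ) a, zpowDiagGL_mem_unitaryGroupOfForm hd.σϖ _ ha.2⟩ :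
          unitaryGroupOfForm σ ((StdForm.antidiagonal N).over K)) :
          unitaryGroupOfForm σ ((StdForm.antidiagonal N).over K) ⧸ unitaryInt σ ((StdForm.antidiagonal N).over K))))
    {r : ℕ} (hr : r ≤ N) :
    (∑ i : Fin N, if N ≤ (i : ℕ) + r then a i else 0) ≤
      ∑ i : Fin N, if N ≤ (i : ℕ) + r then hd.iwasawaExp g i else 0 := by
  have hϖ := hd.vϖ
  have hϖ0 := uniformizer_ne_zero hϖ
  obtain ⟨A, hA, B, hB, hgAB⟩ := (heckeAlgebra.coe_mem_orbit_coe_iff (unitaryInt σ ((StdForm.antidiagonal N).over K)) _ _).1 hg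
  obtain ⟨u, t, k, hu, ht, hk, hutk⟩ := hd.iwasawaExp_spec g
  -- the upper triangular `b = u t = g k⁻¹`
  have hbk : u * t = g * k⁻¹ := by rw [hutk, mul_inv_cancel_right]
  have hbT : (((u * t : unitaryGroupOfForm σ ((StdForm.antidiagonal N).over K)) : GL (Fin N) K) :
      Matrix (Fin N) (Fin N) K).BlockTriangular id := by
    rw [Subgroup.coe_mul, ht]
    exact blockTriangular_mul_zpowDiagGL hu hϖ0 _
  have hdiag : ∀ i, Valued.v ((((u * t : unitaryGroupOfForm σ ((StdForm.antidiagonal N).over K)) : GL (Fin N) K) :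
      Matrix (Fin N) (Fin N) K) i i) = WithZero.exp (-hd.iwasawaExp g i) := fun i => by
    rw [hd.v_apply_self_eq_exp_neg_iwasawaExp hbT i, hbk, hd.iwasawaExp_mul_of_mem_unitaryInt g (Subgroup.inv_mem _ hk)]
  -- `b = A · diag(ϖ^a) · B · k⁻¹` as matrices
  have hmat : (((u * t : unitaryGroupOfForm σ ((StdForm.antidiagonal N).over K)) : GL (Fin N) K) : Matrix (Fin N) (Fin N) K) =
      ((A : GL (Fin N) K) : Matrix (Fin N) (Fin N) K) * (Matrix.diagonal fun i => ϖ ^ a i) *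
        ((B : GL (Fin N) K) : Matrix (Fin N) (Fin N) K) * (((k : GL (Fin N) K)⁻¹ : GL (Fin N) K) : Matrix (Fin N) (Fin N) K) := by
    rw [hbk, hgAB, Subgroup.coe_mul, Subgroup.coe_inv, Subgroup.coe_mul, Subgroup.coe_mul, Units.val_mul, Units.val_mul,
      Units.val_mul, coe_zpowDiagGL]
  exact sum_ite_le_sum_ite_of_blockTriangular_eq hϖ ha.1 hbT hdiag (mem_unitaryInt_iff.1 hA).1 (mem_unitaryInt_iff.1 hB).1
    (mem_unitaryInt_iff.1 hk).2 hmat hr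

/-- **BRUHAT–TITS (4.4.4) (i) FOR `U(σ, J₀)`** («Si `K.t.K ∩ B̂⁰.t'.K ≠ ∅`, on a `t' ≤ t`»): if the coset `gK₀` lies in
`K₀ diag(ϖ^a) K₀` with `a` antitone and `a ∘ rev = -a`, then the Iwasawa exponents `a(g)` (`g ∈ N · diag(ϖ^{a(g)}) · K₀`)
are DOMINATED by `a`: `∑_{i < r} a(g)_i ≤ ∑_{i < r} a_i` for every `r`. [cite: BruhatTits1972, (4.4.4) (i)]
[cite: CartierCorvallis1979, §IV, proof of Thm. 4.1] -/
theorem sum_iwasawaExp_head_le (hd : UnramifiedLocalConjDatum σ ϖ) {a : Fin N → ℤ}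
    (ha : Antitone a ∧ ∀ i, a (Fin.rev i) = -a i) {g : unitaryGroupOfForm σ ((StdForm.antidiagonal N).over K)}
    (hg : (g : unitaryGroupOfForm σ ((StdForm.antidiagonal N).over K) ⧸ unitaryInt σ ((StdForm.antidiagonal N).over K)) ∈
      MulAction.orbit (unitaryInt σ ((StdForm.antidiagonal N).over K))
        (((⟨zpowDiagGL (uniformizer_ne_zero hd.vϖ) a, zpowDiagGL_mem_unitaryGroupOfForm hd.σϖ _ ha.2⟩ :
          unitaryGroupOfForm σ ((StdForm.antidiagonal N).over K)) :
          unitaryGroupOfForm σ ((StdForm.antidiagonal N).over K) ⧸ unitaryInt σ ((StdForm.antidiagonal N).over K))))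
    (r : ℕ) :
    (∑ i : Fin N, if (i : ℕ) < r then hd.iwasawaExp g i else 0) ≤ ∑ i : Fin N, if (i : ℕ) < r then a i else 0 := by
  -- reduce to `r ≤ N`
  wlog hr : r ≤ N generalizing r
  · have h := this N le_rfl
    have h1 : ∀ f : Fin N → ℤ, (∑ i : Fin N, if (i : ℕ) < r then f i else 0) = ∑ i : Fin N, if (i : ℕ) < N then f i else 0 :=
      fun f => Finset.sum_congr rfl fun i _ => by rw [if_pos (by omega), if_pos i.isLt]
    rw [h1, h1]
    exact h
  have h := hd.sum_iwasawaExp_tail_ge ha hg hr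
  rw [sum_ite_rev_eq_neg ha.2, sum_ite_rev_eq_neg (hd.iwasawaExp_rev g), neg_le_neg_iff] at h
  exact h

/-- The coset of `diag(ϖ^a)` itself has Iwasawa exponents `a` (the top term). [cite: BruhatTits1972, (4.4.4) (ii)] -/
theorem iwasawaExp_out_zpowDiagGL (hd : UnramifiedLocalConjDatum σ ϖ) {a : Fin N → ℤ} (ha : ∀ i, a (Fin.rev i) = -a i) :
    hd.iwasawaExp ((⟨zpowDiagGL (uniformizer_ne_zero hd.vϖ) a, zpowDiagGL_mem_unitaryGroupOfForm hd.σϖ _ ha⟩ :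
          unitaryGroupOfForm σ ((StdForm.antidiagonal N).over K)) :
          unitaryGroupOfForm σ ((StdForm.antidiagonal N).over K) ⧸ unitaryInt σ ((StdForm.antidiagonal N).over K)).out = a := by
  rw [iwasawaExp_out_coe]
  exact hd.iwasawaExp_zpowDiagGL ha

/-- **Equality case of (4.4.4) (i)**: if `gK₀ ⊆ K₀ diag(ϖ^a) K₀` (`a` antitone, `a ∘ rev = -a`) and the head sums of
`a` are conversely bounded by those of `a(g)`, then `a(g) = a`. [cite: BruhatTits1972, (4.4.4) (i)] -/
theorem iwasawaExp_eq_of_mem_orbit_of_forall_le (hd : UnramifiedLocalConjDatum σ ϖ) {a : Fin N → ℤ}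
    (ha : Antitone a ∧ ∀ i, a (Fin.rev i) = -a i) {g : unitaryGroupOfForm σ ((StdForm.antidiagonal N).over K)}
    (hg : (g : unitaryGroupOfForm σ ((StdForm.antidiagonal N).over K) ⧸ unitaryInt σ ((StdForm.antidiagonal N).over K)) ∈
      MulAction.orbit (unitaryInt σ ((StdForm.antidiagonal N).over K))
        (((⟨zpowDiagGL (uniformizer_ne_zero hd.vϖ) a, zpowDiagGL_mem_unitaryGroupOfForm hd.σϖ _ ha.2⟩ :
          unitaryGroupOfForm σ ((StdForm.antidiagonal N).over K)) :
          unitaryGroupOfForm σ ((StdForm.antidiagonal N).over K) ⧸ unitaryInt σ ((StdForm.antidiagonal N).over K))))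
    (hle : ∀ r : ℕ, (∑ i : Fin N, if (i : ℕ) < r then a i else 0) ≤ ∑ i : Fin N, if (i : ℕ) < r then hd.iwasawaExp g i else 0) :
    hd.iwasawaExp g = a :=
  eq_of_forall_sum_ite_lt_eq fun r => le_antisymm (hd.sum_iwasawaExp_head_le ha hg r) (hle r)

end UnramifiedLocalConjDatum

end Literature.NumberTheory.Automorphic.HermitianLattice

end
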